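import Summits.HodgeConjecture.CorCM.PairFlipCMFieldTimesReflexFieldHodge
import HarnessLib

/-!
# A generic CM abelian variety times a realisation of its REFLEX TYPE: `Hg(A × A*) = Hg(A) × Hg(A*)` in every degree —
# the reflex type is never of constant unequal incidence

COR-CM (cell `pub-hodgecm2`, binder seat `b16` gen 53, count-neutral claim ORBIT-CRITERION, file F5 — abstract reflex slot
(§1) and CM fields / abelian varieties (§2–§3); theorems only, no definition, no named fact, no `sorry`).  NEW as stated,
hence under `Summits/`.  HONEST FRAMING: unconditional statements about pairs of CM types and products of CM abelian
varieties; `HC_CM` is neither used nor asserted.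

SETTING of F4a/F4b (`StabiliserOrbitReflexSlot`, `PairFlipCMFieldTimesReflexFieldHodge`): `K_{i₀}` with PAIR FLIPS, type
`Φ₀`, `ψ₀ : K_{i₁} → ℂ` a reflex embedding for `Φ₀` (`Fix ψ₀ = Stab Φ₀`), attached types `x ∈ T(y) ⟺ ∃ σ, σψ₀ = y ∧
σ⁻¹x ∈ Φ₀`.  The REFLEX TYPE of `Φ₀` at a base embedding `x₁ : K_{i₀} → ℂ` is the type of `K_{i₁}`
`Φ₀*(x₁) = {y : x₁ ∈ T y} = {σψ₀ : σ⁻¹x₁ ∈ Φ₀}` — Shimura's `{σ⁻¹|_{K*} : σ|_K ∈ Φ₀}` read through `ψ₀` and `x₁`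
([Shimura1998] §8.3 (the reflex of a CM type); it is a CM type of the reflex slot: `mem_typeMap_or_mem_typeMap_rho_smul`).
F4 decided the pair `(Φ₀, Φ₁)` by the INCIDENCE NUMBERS `N(x) = #{y ∈ Φ₁ : x ∈ T y}`.  For `Φ₁ = Φ₀*(x₁)` these are the
numbers of translates of `Φ₀` containing BOTH `x₁` and `x`, and they are never constant-unequal on / off `Φ₀` as soon as
`[K_{i₀} : ℚ] ≥ 4`:

* §1 (abstract, ns `ReflexSlot`) **`not_exists_incidence_of_reflexType`** — if `x₁ ∈ Φ₀`: `N(x₁) = #Φ₀*` while for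
  `x₂ ∈ Φ₀ ∖ {x₁}` the flip at `x₂` produces a translate containing `x₁` but not `x₂`, so `N(x₂) < N(x₁)`; if
  `x̄₁ ∈ Φ₀`: `N(x̄₁) = 0` while the flip at `x₁` produces a translate containing `x₁` and `x₂`, so `N(x₂) > 0`.  Hence
  (F4a's criterion) **`typeRank_sigmaType_add_card_eq_of_pairFlip_of_reflexType`**: the pair `(Φ₀, Φ₀*)` is ADDITIVE, and
  `typeRank_sigmaType_eq_iff_of_pairFlip_of_reflexType`: nondegenerate IFF `Φ₀*` is.
* §2 (CM fields) **`cmFamilyRank_add_card_eq_of_pairFlip_of_reflexType`** — `K_{i₀}` generic of degree `≥ 4`, `Φ₁` the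
  reflex type at `x₁` read through `ψ₀`: `rank(Φ₀, Φ₁) + 2 = rank Φ₀ + rank Φ₁ + 1` (`Hg(A × A*) = Hg(A) × Hg(A*)`),
  **`isNondegenerateFamily_iff_of_pairFlip_of_reflexType`**: the pair is nondegenerate IFF the reflex type is (degree 4:
  the `D₄` surface and its reflex surface, yes; degree 6: no — the reflex type of a generic sextic type has rank 4 < 5,
  [Dodson1984] §3.3.2, and gen 45 recorded «`T × T^{reflex}` is additive»; here every degree).
* §3 (abelian varieties) **`hodgeConjectureFor_prod_of_pairFlip_of_reflexType`** (HC with `B• = D•` on every `A^a × (A*)^b`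
  when the reflex type is nondegenerate — unconditionally), **`forall_prod_hodgeClassSpan_eq_iff_of_pairFlip_of_reflexType`**
  (simple non-isogenous `A`, `A*`: `B• = D•` on all `A^a × (A*)^b` IFF `B• = D•` on all powers of `A*` alone, i.e. IFF
  `Φ₀*` is nondegenerate: every exceptional class of the pair comes from the reflex variety).

## References

* [Shimura1998] G. Shimura, *Abelian Varieties with Complex Multiplication and Modular Functions*, §8.3 (reflex field,
  reflex type, Prop. 28), §8.4.
* [Dodson1984] B. Dodson, *The structure of Galois groups of CM-fields*, Trans. AMS 283 (1984), §1 (Reflex Degree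
  Theorem), §1.1, §3.3.2, §5.1.2.
* [Gordon1999HodgeAVSurvey] B. B. Gordon, *A survey of the Hodge conjecture for abelian varieties*, §3 Theorem, 7.5–7.7,
  9.4.3, 10.10.
-/

set_option autoImplicit false

noncomputable section

open scoped BigOperators

universe u v

namespace Summit.HodgeConjecture.CorCM

namespace ReflexSlot

open Literature.NumberTheory.ComplexMultiplication
open scoped Classical

variable {G : Type u} [Group G]

/-! ### §1 The reflex type is never of constant unequal incidence -/

section Abstract

variable {Z Y : Type*} [MulAction G Z] [MulAction G Y] [Fintype Y] {ρ : G} {Φ₀ : Set Z} {T : Y → Set Z} {y₀ : Y}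

/-- **The reflex type has non-constant incidence on the base type.**  Pair flips on `Z`, `T` a type map, `Ψ = {y : x₁ ∈ T y}`
the reflex type at `x₁`, and some `x₂ ∈ Φ₀ ∖ {x₁, ρx₁}`: the incidence numbers `#{y ∈ Ψ : x ∈ T y}` are NOT `a` on `Φ₀`,
`b` off `Φ₀` with `a ≠ b` (flip at `x₂`, resp. at `x₁`, applied to `y₀`). [cite: Dodson1984, §1.1 and §5.1.2]
[cite: Shimura1998, §8.3 Prop. 28] -/
theorem not_exists_incidence_of_reflexType (hΦ : IsCMTypeWith ρ Φ₀)
    (hT : ∀ (g : G) (y : Y) (x : Z), x ∈ T (g • y) ↔ g⁻¹ • x ∈ T y) (hT₀ : T y₀ = Φ₀)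
    (hY : ∀ y : Y, ∃ g : G, g • y₀ = y)
    (hflip : ∀ x : Z, ∃ φ : G, φ • x = ρ • x ∧ ∀ x' : Z, x' ≠ x → x' ≠ ρ • x → φ • x' = x')
    {Ψ : Set Y} {x₁ : Z} (hΨ : ∀ y : Y, y ∈ Ψ ↔ x₁ ∈ T y) (hx₂ : ∃ x₂ ∈ Φ₀, x₂ ≠ x₁ ∧ x₂ ≠ ρ • x₁) :
    ¬ ∃ a b : ℕ, a ≠ b ∧ ∀ x : Z,
      (Finset.univ.filter fun y : Y => y ∈ Ψ ∧ x ∈ T y).card = if x ∈ Φ₀ then a else b := by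
  rintro ⟨a, b, -, hN⟩
  obtain ⟨x₂, hx₂Φ, h21, h2ρ1⟩ := hx₂
  have h1ρ2 : x₁ ≠ ρ • x₂ := by
    intro h
    apply h2ρ1
    rw [h, hΦ.invol]
  by_cases hx₁ : x₁ ∈ Φ₀
  · -- `N(x₂) = N(x₁) = a`: every translate containing `x₁` contains `x₂` — contradicted by the flip at `x₂`
    have hN₁ := hN x₁
    have hN₂ := hN x₂
    rw [if_pos hx₁] at hN₁
    rw [if_pos hx₂Φ] at hN₂
    have hsub : (Finset.univ.filter fun y : Y => y ∈ Ψ ∧ x₂ ∈ T y) ⊆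
        Finset.univ.filter fun y : Y => y ∈ Ψ ∧ x₁ ∈ T y := by
      intro y hy
      rw [Finset.mem_filter] at hy ⊢
      exact ⟨hy.1, hy.2.1, (hΨ y).1 hy.2.1⟩
    have heq := Finset.eq_of_subset_of_card_le hsub (by rw [hN₁, hN₂])
    obtain ⟨φ, hφx, hφ⟩ := hflip x₂
    have hin : φ • y₀ ∈ Finset.univ.filter fun y : Y => y ∈ Ψ ∧ x₁ ∈ T y := by
      rw [Finset.mem_filter]
      have h1 : x₁ ∈ T (φ • y₀) := by
        rw [mem_typeMap_smul_iff_of_smul_eq hT (hφ x₁ (Ne.symm h21) h1ρ2) y₀, hT₀]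
        exact hx₁
      exact ⟨Finset.mem_univ _, (hΨ _).2 h1, h1⟩
    rw [← heq, Finset.mem_filter] at hin
    have h2 : x₂ ∉ T (φ • y₀) := by
      rw [mem_typeMap_smul_iff_of_smul_rho_eq hΦ hT hT₀ hY (smul_rho_eq_of_pairFlip hΦ hφx) y₀, hT₀, not_not]
      exact hx₂Φ
    exact h2 hin.2.2
  · -- `N(ρx₁) = 0 = a`, but the flip at `x₁` produces a translate containing `x₁` and `x₂`
    have hρx₁ : ρ • x₁ ∈ Φ₀ := (hΦ.rho_smul_mem_iff x₁).2 hx₁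
    have hN₁ := hN (ρ • x₁)
    have hN₂ := hN x₂
    rw [if_pos hρx₁] at hN₁
    rw [if_pos hx₂Φ] at hN₂
    have hempty : (Finset.univ.filter fun y : Y => y ∈ Ψ ∧ ρ • x₁ ∈ T y) = ∅ := by
      refine Finset.filter_eq_empty_iff.2 fun y _ hy => ?_
      exact (rho_smul_mem_typeMap_iff hΦ hT hT₀ hY y x₁).1 hy.2 ((hΨ y).1 hy.1)
    rw [hempty, Finset.card_empty] at hN₁
    obtain ⟨φ, hφx, hφ⟩ := hflip x₁
    have hin : φ • y₀ ∈ Finset.univ.filter fun y : Y => y ∈ Ψ ∧ x₂ ∈ T y := by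
      rw [Finset.mem_filter]
      have h1 : x₁ ∈ T (φ • y₀) := by
        rw [mem_typeMap_smul_iff_of_smul_rho_eq hΦ hT hT₀ hY (smul_rho_eq_of_pairFlip hΦ hφx) y₀, hT₀]
        exact hx₁
      have h2 : x₂ ∈ T (φ • y₀) := by
        rw [mem_typeMap_smul_iff_of_smul_eq hT (hφ x₂ h21 h2ρ1) y₀, hT₀]
        exact hx₂Φ
      exact ⟨Finset.mem_univ _, (hΨ _).2 h1, h2⟩
    have hpos : 0 < (Finset.univ.filter fun y : Y => y ∈ Ψ ∧ x₂ ∈ T y).card := Finset.card_pos.2 ⟨_, hin⟩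
    omega

end Abstract

/-! ### §1b Families: the base against its reflex type is additive -/

section Family

variable {I : Type v} {E : I → Type v} [∀ i, MulAction G (E i)] [DecidableEq I] [Fintype I] [∀ i, Fintype (E i)]
  {ρ : G} {Φ : ∀ i, Set (E i)} {i₀ i₁ : I} [Nonempty I] [∀ i, Nonempty (E i)]
  {T : E i₁ → Set (E i₀)} {y₀ : E i₁}

/-- **The pair (base type, reflex type) is ADDITIVE**: `rank(Σ) + |I| = Σ_i rank(Φ_i) + 1` (`Hg(A × A*) = Hg(A) × Hg(A*)`)
for a pair-flip base with at least two pairs and `Φ_{i₁} = {y : x₁ ∈ T y}`.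
[cite: Gordon1999HodgeAVSurvey, §3 Theorem (1), 7.5–7.7 and 9.4.3] [cite: Dodson1984, §3.3.2 and §5.1.2] -/
theorem typeRank_sigmaType_add_card_eq_of_pairFlip_of_reflexType [MulAction.IsPretransitive G (E i₀)]
    (h : ∀ i, IsCMTypeWith ρ (Φ i)) (hI : ∀ j, j = i₀ ∨ j = i₁) (h01 : i₀ ≠ i₁)
    (hflip : ∀ x : E i₀, ∃ φ : G, φ • x = ρ • x ∧ ∀ x' : E i₀, x' ≠ x → x' ≠ ρ • x → φ • x' = x')
    (hT : ∀ (g : G) (y : E i₁) (x : E i₀), x ∈ T (g • y) ↔ g⁻¹ • x ∈ T y) (hTi : Function.Injective T)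
    (hT₀ : T y₀ = Φ i₀) (hY : ∀ y : E i₁, ∃ g : G, g • y₀ = y) {x₁ : E i₀}
    (hΦ₁ : ∀ y : E i₁, y ∈ Φ i₁ ↔ x₁ ∈ T y) (hx₂ : ∃ x₂ ∈ Φ i₀, x₂ ≠ x₁ ∧ x₂ ≠ ρ • x₁) :
    typeRank G (sigmaType Φ) + Fintype.card I = (∑ i, typeRank G (Φ i)) + 1 :=
  (typeRank_sigmaType_add_card_eq_iff_of_pairFlip_of_typeMap h hI h01 hflip hT hTi hT₀ hY).2
    (not_exists_incidence_of_reflexType (h i₀) hT hT₀ hY hflip hΦ₁ hx₂)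

/-- **The pair (base type, reflex type) is nondegenerate IFF the reflex type is.**
[cite: Gordon1999HodgeAVSurvey, 7.5–7.7 and 9.4.3] [cite: Dodson1984, §3.3.2 and §5.1.2] -/
theorem typeRank_sigmaType_eq_iff_of_pairFlip_of_reflexType [MulAction.IsPretransitive G (E i₀)]
    (h : ∀ i, IsCMTypeWith ρ (Φ i)) (hI : ∀ j, j = i₀ ∨ j = i₁) (h01 : i₀ ≠ i₁)
    (hflip : ∀ x : E i₀, ∃ φ : G, φ • x = ρ • x ∧ ∀ x' : E i₀, x' ≠ x → x' ≠ ρ • x → φ • x' = x')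
    (hT : ∀ (g : G) (y : E i₁) (x : E i₀), x ∈ T (g • y) ↔ g⁻¹ • x ∈ T y) (hTi : Function.Injective T)
    (hT₀ : T y₀ = Φ i₀) (hY : ∀ y : E i₁, ∃ g : G, g • y₀ = y) {x₁ : E i₀}
    (hΦ₁ : ∀ y : E i₁, y ∈ Φ i₁ ↔ x₁ ∈ T y) (hx₂ : ∃ x₂ ∈ Φ i₀, x₂ ≠ x₁ ∧ x₂ ≠ ρ • x₁) :
    typeRank G (sigmaType Φ) = Fintype.card (Σ i, E i) / 2 + 1 ↔
      typeRank G (Φ i₁) = Fintype.card (E i₁) / 2 + 1 := by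
  rw [typeRank_sigmaType_eq_iff_of_pairFlip_of_typeMap h hI h01 hflip hT hTi hT₀ hY]
  exact ⟨fun h' => h'.1, fun h' => ⟨h', not_exists_incidence_of_reflexType (h i₀) hT hT₀ hY hflip hΦ₁ hx₂⟩⟩

end Family

end ReflexSlot

/-! ### §2 CM fields: a generic field against its reflex type -/

open CategoryTheory CategoryTheory.Limits NumberField Module
open Literature.NumberTheory.ComplexMultiplication
open Literature.AlgebraicGeometry.Motives (AbelianVariety CMType)
open Literature.AlgebraicGeometry.HodgeTheory
open Literature.AlgebraicGeometry.ComplexMultiplication (IsCMTypeRealisation)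
open Literature.AlgebraicGeometry.VanGeemen1994 (hodgeClassSpan)
open Literature.AlgebraicGeometry.Pohlmann1968
open Literature.Barriers.HodgeConjecture (divisorClassesSpan)
open scoped Classical

variable {I : Type} {K : I → Type} [∀ i, Field (K i)] [∀ i, NumberField (K i)] [∀ i, IsCMField (K i)] [Fintype I]
  [DecidableEq I] {Φ : ∀ i, CMType (K i)} {i₀ i₁ : I}

omit [∀ i, IsCMField (K i)] [DecidableEq I] in
/-- `|⊔_i Hom(K_i, ℂ)| = Σ_i [K_i : ℚ]`. [folklore] -/
private theorem card_sigma_ringHom_eq_sum₅₃'' : Fintype.card ((i : I) × (K i →+* ℂ)) = ∑ i, finrank ℚ (K i) := by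
  rw [Fintype.card_sigma]
  exact Finset.sum_congr rfl fun i _ => Embeddings.card (K i) ℂ

section Types

omit [Fintype I] [DecidableEq I] in
/-- A CM type of a field of degree `≥ 4` has a point outside any given conjugate pair `{x₁, x̄₁}`. [cite: Shimura1998, §18.1] -/
theorem exists_mem_cmType_ne_ne (Φ₀ : CMType (K i₀)) (h4 : 4 ≤ finrank ℚ (K i₀)) (x₁ : K i₀ →+* ℂ) :
    ∃ x₂ ∈ Φ₀.1, x₂ ≠ x₁ ∧ x₂ ≠ (starRingAut : ℂ ≃+* ℂ) • x₁ := by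
  have hcard : 1 < (Finset.univ.filter fun φ : K i₀ →+* ℂ => φ ∈ Φ₀.1).card := by
    have := two_mul_card_filter_mem_cmType Φ₀
    omega
  obtain ⟨u, hu, v, hv, huv⟩ := Finset.one_lt_card.1 hcard
  rw [Finset.mem_filter] at hu hv
  have hΦ := isCMTypeWith_conj Φ₀
  by_cases hx₁ : x₁ ∈ Φ₀.1
  · have hρ : (starRingAut : ℂ ≃+* ℂ) • x₁ ∉ Φ₀.1 := fun h' => (hΦ.rho_smul_mem_iff x₁).1 h' hx₁
    by_cases hux : u = x₁
    · subst hux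
      exact ⟨v, hv.2, Ne.symm huv, fun h' => hρ (h' ▸ hv.2)⟩
    · exact ⟨u, hu.2, hux, fun h' => hρ (h' ▸ hu.2)⟩
  · by_cases hux : u = (starRingAut : ℂ ≃+* ℂ) • x₁
    · subst hux
      exact ⟨v, hv.2, fun h' => hx₁ (h' ▸ hv.2), Ne.symm huv⟩
    · exact ⟨u, hu.2, fun h' => hx₁ (h' ▸ hu.2), hux⟩

/-- **GENERIC FIELD × ITS REFLEX TYPE IS ADDITIVE (every degree `≥ 4`).**  `I = {i₀, i₁}`, `K_{i₀}` with pair flips and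
`[K_{i₀} : ℚ] ≥ 4`, `ψ₀` a reflex embedding for `Φ₀`, `Φ₁ = {σψ₀ : σ⁻¹x₁ ∈ Φ₀}` the reflex type at `x₁` read through
`ψ₀`: `rank(Φ₀, Φ₁) + 2 = rank Φ₀ + rank Φ₁ + 1` (`Hg(A × A*) = Hg(A) × Hg(A*)`).
[cite: Gordon1999HodgeAVSurvey, §3 Theorem (1) and 7.5–7.7] [cite: Shimura1998, §8.3 Prop. 28] [cite: Dodson1984, §3.3.2 and §5.1.2] -/
theorem cmFamilyRank_add_card_eq_of_pairFlip_of_reflexType (hI : ∀ i, i = i₀ ∨ i = i₁) (h01 : i₀ ≠ i₁)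
    (hflip₀ : ∀ x : K i₀ →+* ℂ, ∃ σ : ℂ ≃+* ℂ, σ • x = (starRingAut : ℂ ≃+* ℂ) • x ∧
      ∀ x' : K i₀ →+* ℂ, x' ≠ x → x' ≠ (starRingAut : ℂ ≃+* ℂ) • x → σ • x' = x')
    (h4 : 4 ≤ finrank ℚ (K i₀)) {ψ₀ : K i₁ →+* ℂ}
    (hψ₀ : ∀ σ : ℂ ≃+* ℂ, σ • ψ₀ = ψ₀ ↔ ∀ x : K i₀ →+* ℂ, σ • x ∈ (Φ i₀).1 ↔ x ∈ (Φ i₀).1) {x₁ : K i₀ →+* ℂ}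
    (hΦ₁ : ∀ y : K i₁ →+* ℂ, y ∈ (Φ i₁).1 ↔ ∃ σ : ℂ ≃+* ℂ, σ • ψ₀ = y ∧ σ⁻¹ • x₁ ∈ (Φ i₀).1) :
    CMAlgebra.cmFamilyRank Φ + Fintype.card I = (∑ i, cmTypeRank (Φ i)) + 1 := by
  haveI := isPretransitive_ringEquiv_complex (K := K i₀)
  haveI : Nonempty I := ⟨i₀⟩
  obtain ⟨T, hT, hTi, hT₀, hY, hmem⟩ := exists_typeMap_of_reflexEmbedding (Φ i₀) hψ₀
  have hΦ₁' : ∀ y : K i₁ →+* ℂ, y ∈ (Φ i₁).1 ↔ x₁ ∈ T y := fun y => by rw [hΦ₁ y, hmem x₁ y]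
  exact ReflexSlot.typeRank_sigmaType_add_card_eq_of_pairFlip_of_reflexType (G := ℂ ≃+* ℂ) (Φ := fun i => (Φ i).1)
    (fun i => isCMTypeWith_conj (Φ i)) hI h01 hflip₀ hT hTi hT₀ hY hΦ₁' (exists_mem_cmType_ne_ne (Φ i₀) h4 x₁)

/-- **GENERIC FIELD × ITS REFLEX TYPE: nondegenerate IFF the reflex type is nondegenerate** (every degree `≥ 4`).
[cite: Gordon1999HodgeAVSurvey, 7.5–7.7] [cite: Dodson1984, §3.3.2 and §5.1.2] [cite: Shimura1998, §8.3 Prop. 28] -/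
theorem isNondegenerateFamily_iff_of_pairFlip_of_reflexType (hI : ∀ i, i = i₀ ∨ i = i₁) (h01 : i₀ ≠ i₁)
    (hflip₀ : ∀ x : K i₀ →+* ℂ, ∃ σ : ℂ ≃+* ℂ, σ • x = (starRingAut : ℂ ≃+* ℂ) • x ∧
      ∀ x' : K i₀ →+* ℂ, x' ≠ x → x' ≠ (starRingAut : ℂ ≃+* ℂ) • x → σ • x' = x')
    (h4 : 4 ≤ finrank ℚ (K i₀)) {ψ₀ : K i₁ →+* ℂ}
    (hψ₀ : ∀ σ : ℂ ≃+* ℂ, σ • ψ₀ = ψ₀ ↔ ∀ x : K i₀ →+* ℂ, σ • x ∈ (Φ i₀).1 ↔ x ∈ (Φ i₀).1) {x₁ : K i₀ →+* ℂ}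
    (hΦ₁ : ∀ y : K i₁ →+* ℂ, y ∈ (Φ i₁).1 ↔ ∃ σ : ℂ ≃+* ℂ, σ • ψ₀ = y ∧ σ⁻¹ • x₁ ∈ (Φ i₀).1) :
    CMAlgebra.IsNondegenerateFamily Φ ↔ IsNondegenerate (Φ i₁) := by
  haveI := isPretransitive_ringEquiv_complex (K := K i₀)
  haveI : Nonempty I := ⟨i₀⟩
  obtain ⟨T, hT, hTi, hT₀, hY, hmem⟩ := exists_typeMap_of_reflexEmbedding (Φ i₀) hψ₀
  have hΦ₁' : ∀ y : K i₁ →+* ℂ, y ∈ (Φ i₁).1 ↔ x₁ ∈ T y := fun y => by rw [hΦ₁ y, hmem x₁ y]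
  have key := ReflexSlot.typeRank_sigmaType_eq_iff_of_pairFlip_of_reflexType (G := ℂ ≃+* ℂ) (Φ := fun i => (Φ i).1)
    (fun i => isCMTypeWith_conj (Φ i)) hI h01 hflip₀ hT hTi hT₀ hY hΦ₁' (exists_mem_cmType_ne_ne (Φ i₀) h4 x₁)
  rw [CMAlgebra.isNondegenerateFamily_iff, ← card_sigma_ringHom_eq_sum₅₃'' (K := K), isNondegenerate_iff, cmTypeRank,
    ← Embeddings.card (K i₁) ℂ]
  exact key

/-- **The same from the IMAGE of `ψ₀`** (`ψ₀(K_{i₁}) = traceField Φ₀`, the complex reflex field): `Hg(A × A*) = Hg(A) × Hg(A*)`.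
[cite: Shimura1998, §8.3 Prop. 28] [cite: Gordon1999HodgeAVSurvey, §3 Theorem (1) and 7.5–7.7] -/
theorem cmFamilyRank_add_card_eq_of_pairFlip_of_reflexType_of_range_eq_traceField (hI : ∀ i, i = i₀ ∨ i = i₁)
    (h01 : i₀ ≠ i₁)
    (hflip₀ : ∀ x : K i₀ →+* ℂ, ∃ σ : ℂ ≃+* ℂ, σ • x = (starRingAut : ℂ ≃+* ℂ) • x ∧
      ∀ x' : K i₀ →+* ℂ, x' ≠ x → x' ≠ (starRingAut : ℂ ≃+* ℂ) • x → σ • x' = x')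
    (h4 : 4 ≤ finrank ℚ (K i₀)) {ψ₀ : K i₁ →+* ℂ} (hr : Set.range ψ₀ = (traceField (Φ i₀) : Set ℂ)) {x₁ : K i₀ →+* ℂ}
    (hΦ₁ : ∀ y : K i₁ →+* ℂ, y ∈ (Φ i₁).1 ↔ ∃ σ : ℂ ≃+* ℂ, σ • ψ₀ = y ∧ σ⁻¹ • x₁ ∈ (Φ i₀).1) :
    CMAlgebra.cmFamilyRank Φ + Fintype.card I = (∑ i, cmTypeRank (Φ i)) + 1 :=
  cmFamilyRank_add_card_eq_of_pairFlip_of_reflexType hI h01 hflip₀ h4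
    (smul_eq_iff_forall_smul_mem_iff_of_range_eq_traceField (Φ i₀) ψ₀ hr) hΦ₁

end Types

/-! ### §3 Abelian varieties -/

section Varieties

variable [Nonempty I] {A : I → AbelianVariety ℂ} {ι : ∀ i, 𝓞 (K i) →+* End (A i)}
  {θ : ∀ i, K i →+* Module.End ℂ (complexBetti (A i).X 1)}

/-- **The Hodge conjecture on every `A^a × (A*)^b`** (every `⨁_{j<N} A_{π j}`), with `B• = D•` there, for a realisation `A`
of a type of a pair-flip CM field of degree `≥ 4` and a realisation `A*` of its reflex type, PROVIDED the reflex type is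
nondegenerate — UNCONDITIONALLY. [cite: Gordon1999HodgeAVSurvey, 7.5 and 10.10] -/
theorem hodgeConjectureFor_prod_of_pairFlip_of_reflexType (hI : ∀ i, i = i₀ ∨ i = i₁) (h01 : i₀ ≠ i₁)
    (hflip₀ : ∀ x : K i₀ →+* ℂ, ∃ σ : ℂ ≃+* ℂ, σ • x = (starRingAut : ℂ ≃+* ℂ) • x ∧
      ∀ x' : K i₀ →+* ℂ, x' ≠ x → x' ≠ (starRingAut : ℂ ≃+* ℂ) • x → σ • x' = x')
    (h4 : 4 ≤ finrank ℚ (K i₀)) {ψ₀ : K i₁ →+* ℂ}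
    (hψ₀ : ∀ σ : ℂ ≃+* ℂ, σ • ψ₀ = ψ₀ ↔ ∀ x : K i₀ →+* ℂ, σ • x ∈ (Φ i₀).1 ↔ x ∈ (Φ i₀).1) {x₁ : K i₀ →+* ℂ}
    (hΦ₁ : ∀ y : K i₁ →+* ℂ, y ∈ (Φ i₁).1 ↔ ∃ σ : ℂ ≃+* ℂ, σ • ψ₀ = y ∧ σ⁻¹ • x₁ ∈ (Φ i₀).1)
    (hnd : IsNondegenerate (Φ i₁)) (hA : ∀ i, IsCMTypeRealisation (Φ i) (A i) (ι i) (θ i)) {N : ℕ} (π : Fin N → I) :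
    HodgeConjectureFor (⨁ fun j : Fin N => A (π j)).dim (⨁ fun j : Fin N => A (π j)).X ∧
      ∀ m : ℕ, hodgeClassSpan (⨁ fun j : Fin N => A (π j)).dim (⨁ fun j : Fin N => A (π j)).X m =
        divisorClassesSpan (⨁ fun j : Fin N => A (π j)).X (⨁ fun j : Fin N => A (π j)).dim m :=
  have h := (isNondegenerateFamily_iff_of_pairFlip_of_reflexType hI h01 hflip₀ h4 hψ₀ hΦ₁).2 hnd
  ⟨h.hodgeConjectureFor_prod hA π, fun m => h.hodgeClassSpan_prod_eq_divisorClassesSpan hA π m⟩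

/-- **SIMPLE, NON-ISOGENOUS `A`, `A*`: `B• = D•` on ALL products `A^a × (A*)^b` IFF the reflex type is nondegenerate** — every
exceptional Hodge class of the pair comes from the reflex variety alone. [cite: Gordon1999HodgeAVSurvey, 7.5 and 7.6.1]
[cite: Dodson1984, §3.3.2] -/
theorem forall_prod_hodgeClassSpan_eq_iff_of_pairFlip_of_reflexType (hI : ∀ i, i = i₀ ∨ i = i₁) (h01 : i₀ ≠ i₁)
    (hflip₀ : ∀ x : K i₀ →+* ℂ, ∃ σ : ℂ ≃+* ℂ, σ • x = (starRingAut : ℂ ≃+* ℂ) • x ∧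
      ∀ x' : K i₀ →+* ℂ, x' ≠ x → x' ≠ (starRingAut : ℂ ≃+* ℂ) • x → σ • x' = x')
    (h4 : 4 ≤ finrank ℚ (K i₀)) {ψ₀ : K i₁ →+* ℂ}
    (hψ₀ : ∀ σ : ℂ ≃+* ℂ, σ • ψ₀ = ψ₀ ↔ ∀ x : K i₀ →+* ℂ, σ • x ∈ (Φ i₀).1 ↔ x ∈ (Φ i₀).1) {x₁ : K i₀ →+* ℂ}
    (hΦ₁ : ∀ y : K i₁ →+* ℂ, y ∈ (Φ i₁).1 ↔ ∃ σ : ℂ ≃+* ℂ, σ • ψ₀ = y ∧ σ⁻¹ • x₁ ∈ (Φ i₀).1)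
    (hA : ∀ i, IsCMTypeRealisation (Φ i) (A i) (ι i) (θ i)) (hs : ∀ i, (A i).IsSimple)
    (hniso : ∀ i i', i ≠ i' → ¬ AbelianVariety.IsIsogenous (A i) (A i')) :
    (∀ (N : ℕ) (π : Fin N → I) (m : ℕ),
      hodgeClassSpan (⨁ fun j : Fin N => A (π j)).dim (⨁ fun j : Fin N => A (π j)).X m =
        divisorClassesSpan (⨁ fun j : Fin N => A (π j)).X (⨁ fun j : Fin N => A (π j)).dim m) ↔
      IsNondegenerate (Φ i₁) := by
  rw [← CMAlgebra.isNondegenerateFamily_iff_forall_prod_hodgeClassSpan_eq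
    (CMAlgebra.isSeparatingFamily_of_isSimple_of_pairwise_not_isIsogenous hA hs hniso) hA]
  exact isNondegenerateFamily_iff_of_pairFlip_of_reflexType hI h01 hflip₀ h4 hψ₀ hΦ₁

end Varieties

end Summit.HodgeConjecture.CorCM

end
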